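import Mathlib
import Summits.NavierStokesRegularity.NavierStokesRegularity.Theorems.SubcriticalEnvelopeForwardSourceTailEnvelopeKPPermStrands
import Summits.NavierStokesRegularity.NavierStokesRegularity.Theorems.SubcriticalEnvelopeForwardSourceTailEnvelopeKPTwoCycleWide
import HarnessLib

/-!
# `SubcriticalEnvelope.ForwardSourceTailEnvelopeKP` (stmt-NavierStokesRegularity-27130) — RUNG: the
ν-uniform shell barrier / tail ceiling / forward-source envelope for UNIFORM KP PERMUTATION NETWORKS
at every scale ratio `ε₀ ∈ [31/50, 1]`, by EXACT REDUCTION to the one-mode chain (file 3 of 3 of the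
LEAD-SE rung «uniform KP permutation networks», `--supports`)

LEAD-SE helper (tenure 13:25:30Z, KEY-NS #140 (2)(ii)).  A uniform KP permutation network is
`kpPermTable σ c` with `c` CONSTANT ON `σ`-ORBITS (one coefficient per cycle; `c = 0` on a cycle =
idle components).  Every honest viscous solution from ANY one-shell datum `X₀ ∈ ℝ⁴` splits into four
honest solutions `permStrand σ a₀ X` of the `(c a₀)·dyadicTable` lattices (data `X₀(a₀)·e₀`;
`permStrand_honest`), to which ns-soc-p2's chain rungs apply; idle strands only decay.

* `permPhase_start` — the strand through the mode `(i,k)` starts at `σ^{-k} i`;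
* `kpPerm_shellBound_of_chain` — RATIO-AGNOSTIC TRANSFER: any ν-uniform weighted shell bound for the
  scaled chains `(c a)·dyadicTable` (`c a ≠ 0`) at ratio `1+ε₀` holds verbatim for `kpPermTable σ c`
  (so every chain rung, present or future, transfers by one line);
* `kpPerm_shellBarrier_range` (`ε₀ ∈ [7/10,1]`, via `dyadicRange_shellBarrier`) and
  `kpPerm_shellBarrier_midRange` (`ε₀ ∈ [31/50,18/25]`, via `dyadicMidRange_shellBarrier`): the bound
  `(1+ε₀)^{2θk}·½X_{i,k}(t)² ≤ 100·Σ½X₀²`, `θ = 101/200`, for `c ≥ 0`;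
* `kpPermWide_shellBarrierAt : ∀ R, ∀ ε₀ ∈ [31/50,1], ShellBarrierAt R ε₀ (kpPermTable σ c)` for EVERY
  orbit-constant `c` (the orthant binder forces the signs), `kpPermWide_ceilingAt`;
* `forwardSourceTailEnvelopeKP_at_kpPerm` (S = univ) and `…_sources` (S := S⁺ = {a : c a ≠ 0}) — the
  27130 clause on this class, through the landed glue (`subOnsagerCeiling_ceilingAt_of_shellBarrierAt`,
  `viscousTailEnvelopeOrthant_uniform_of_ceilingAt`).

With `kpPermTable_one_eq_dyadic` / `kpPermTable_swap_eq_twoCycle` (sibling `…KPPermClass.lean`) this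
rung CONTAINS the chain rungs and the 2-cycle rungs (p636455, p637748): the rung inventory of 27130
becomes {uniform KP permutation networks} × [31/50, 1].  Scope: NON-uniform cycles reduce by the same
strands to PERIODIC chains (`quadTerm_kpPerm_phase`), for which no barrier is in the tree.

HONEST FRAMING: statements about Tao-type MODEL lattice ODEs (rung TL-M2Break); one architecture
class, one ratio range; the cruxes are NOT proved; nothing here concerns the Navier–Stokes equations;
NS regularity is NOT advanced.
-/

noncomputable section

-- the sub-problem namespace `NavierStokesRegularity.NavierStokesRegularity` is the tree's layout (D-0017)
set_option linter.dupNamespace false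

namespace Summit.NavierStokesRegularity.NavierStokesRegularity.Theorems

open Set
open Literature.Analysis.FluidPDE.TaoCascade

open Summit.NavierStokesRegularity.NavierStokesRegularity.Theorems.SubOnsagerCeiling
open Summit.NavierStokesRegularity.NavierStokesRegularity.Theses

/-! ## §7 Chain barrier ⇒ permutation-network barrier (ratio-agnostic transfer) -/

/-- The strand through the mode `(i, k)` starts at `permPhase σ i (-k)`. [this file] -/
theorem permPhase_start (σ : Equiv.Perm (Fin 4)) (i : Fin 4) (k : ℤ) :
    permPhase σ (permPhase σ i (-k)) k = i := by
  simp only [permPhase]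
  rw [← Equiv.Perm.mul_apply, ← zpow_add, add_neg_cancel, zpow_zero, Equiv.Perm.one_apply]

/-- **TRANSFER: any ν-uniform weighted shell bound for the scaled chains gives the same bound for the
permutation network with orbit-constant coefficients, at the same scale ratio.**  If at ratio `1+ε₀`
every honest viscous solution `Y` of the `(c a)·dyadicTable` lattice (any one-shell datum, non-negative
on shells `≥ 1`) obeys `(1+ε₀)^{2θk}·½Y_{i,k}(t)² ≤ D·Σ_j ½Y₀_j²` (`D ≥ 1`) for every component `a`
with `c a ≠ 0`, then every honest viscous solution of `kpPermTable σ c` obeys the same bound with the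
same `θ`, `D`: the mode `(i,k)` sits on the strand of `a₀ = σ^{-k} i`, an honest `(c a₀)`-chain solution
(`permStrand_honest`) with datum energy `½X₀(a₀)² ≤ Σ½X₀²` when `c a₀ ≠ 0`, and a purely damped
amplitude (`sq_le_sq_init_of_damped`) when `c a₀ = 0` (then `c i = c(σ⁻¹ i) = 0`).  The ratio enters
only through the hypothesis, so every chain rung transfers by one line.  MODEL lattice statement.
[this file] -/
theorem kpPerm_shellBound_of_chain {σ : Equiv.Perm (Fin 4)} {c : Fin 4 → ℝ} {ε₀ θ D : ℝ}
    (hcyc : ∀ a, c (σ a) = c a) (hε : 0 < ε₀) (hD1 : 1 ≤ D)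
    (hchain : ∀ a : Fin 4, c a ≠ 0 → ∀ ν : ℝ, 0 < ν → ∀ (Y₀ : Fin 4 → ℝ) (s : ℝ), 0 < s →
      ∀ Y : Fin 4 → ℤ → ℝ → ℝ,
      (∀ (i : Fin 4) (k : ℤ), Y i k 0 = if k = 0 then Y₀ i else 0) →
      (∀ (i : Fin 4) (k : ℤ), k < 0 → ∀ t : ℝ, Y i k t = 0) →
      (∃ M : ℝ, ∀ (t : ℝ) (i : Fin 4) (k : ℤ), (1 + (1 + ε₀) ^ ((10 : ℝ) * k)) * |Y i k t| ≤ M) →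
      (∀ (i : Fin 4) (k : ℤ), Continuous (Y i k)) →
      (∀ (i : Fin 4) (k : ℤ), ∀ t ∈ Set.Icc (0 : ℝ) s, HasDerivWithinAt (Y i k)
        (quadTerm ε₀ (fun i₁ i₂ i₃ μ => c a * dyadicTable i₁ i₂ i₃ μ) Y i k t -
          ν * (1 + ε₀) ^ ((2 : ℝ) * k) * Y i k t) (Set.Icc (0 : ℝ) s) t) →
      (∀ t ∈ Set.Icc (0 : ℝ) s, ∀ (i : Fin 4) (k : ℤ), 1 ≤ k → 0 ≤ Y i k t) →
      ∀ t ∈ Set.Icc (0 : ℝ) s, ∀ (i : Fin 4) (k : ℕ),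
        (1 + ε₀) ^ (2 * θ * (k : ℝ)) * ((1 / 2 : ℝ) * Y i (k : ℤ) t ^ 2) ≤
          D * (∑ j : Fin 4, (1 / 2 : ℝ) * Y₀ j ^ 2)) :
    ∀ ν : ℝ, 0 < ν → ∀ (X₀ : Fin 4 → ℝ) (s : ℝ), 0 < s → ∀ X : Fin 4 → ℤ → ℝ → ℝ,
      (∀ (i : Fin 4) (k : ℤ), X i k 0 = if k = 0 then X₀ i else 0) →
      (∀ (i : Fin 4) (k : ℤ), k < 0 → ∀ t : ℝ, X i k t = 0) →
      (∃ M : ℝ, ∀ (t : ℝ) (i : Fin 4) (k : ℤ), (1 + (1 + ε₀) ^ ((10 : ℝ) * k)) * |X i k t| ≤ M) →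
      (∀ (i : Fin 4) (k : ℤ), Continuous (X i k)) →
      (∀ (i : Fin 4) (k : ℤ), ∀ t ∈ Set.Icc (0 : ℝ) s, HasDerivWithinAt (X i k)
        (quadTerm ε₀ (kpPermTable σ c) X i k t - ν * (1 + ε₀) ^ ((2 : ℝ) * k) * X i k t)
        (Set.Icc (0 : ℝ) s) t) →
      (∀ t ∈ Set.Icc (0 : ℝ) s, ∀ (i : Fin 4) (k : ℤ), 1 ≤ k → 0 ≤ X i k t) →
      ∀ t ∈ Set.Icc (0 : ℝ) s, ∀ (i : Fin 4) (k : ℕ),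
        (1 + ε₀) ^ (2 * θ * (k : ℝ)) * ((1 / 2 : ℝ) * X i (k : ℤ) t ^ 2) ≤
          D * (∑ j : Fin 4, (1 / 2 : ℝ) * X₀ j ^ 2) := by
  intro ν hν X₀ s hs X hinit hlow hbd hcont hder hnn t ht i k
  have hb0 : (0 : ℝ) < 1 + ε₀ := by linarith
  set E₀ : ℝ := ∑ j : Fin 4, (1 / 2 : ℝ) * X₀ j ^ 2 with hE₀
  have hE₀i : ∀ j : Fin 4, (1 / 2 : ℝ) * X₀ j ^ 2 ≤ E₀ := fun j =>
    Finset.single_le_sum (f := fun j => (1 / 2 : ℝ) * X₀ j ^ 2) (fun j _ => by positivity)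
      (Finset.mem_univ j)
  have hE₀0 : 0 ≤ E₀ := Finset.sum_nonneg fun j _ => by positivity
  have hD0 : 0 ≤ D := le_trans zero_le_one hD1
  -- the strand through `(i, k)`
  set a₀ : Fin 4 := permPhase σ i (-(k : ℤ)) with ha₀
  have hph : permPhase σ a₀ (k : ℤ) = i := permPhase_start σ i k
  have hca : c a₀ = c i := by rw [← hph]; exact (orbitConst_permPhase hcyc a₀ (k : ℤ)).symm
  by_cases hc0 : c a₀ = 0
  · -- idle strand: `c i = c (σ⁻¹ i) = 0`, the mode is purely damped
    have hci : c i = 0 := hca ▸ hc0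
    have hcp : c (σ.symm i) = 0 := by
      have h := hcyc (σ.symm i)
      rw [Equiv.apply_symm_apply] at h
      rw [← h, hci]
    have hq0 : ∀ u ∈ Icc (0 : ℝ) s, quadTerm ε₀ (kpPermTable σ c) X i (k : ℤ) u = 0 := by
      intro u _
      rw [quadTerm_kpPerm, hci, hcp, zero_mul, zero_mul, sub_zero]
    have hsq := sq_le_sq_init_of_damped (y := X i (k : ℤ))
      (q := fun u => quadTerm ε₀ (kpPermTable σ c) X i (k : ℤ) u)
      (c := ν * (1 + ε₀) ^ ((2 : ℝ) * ((k : ℕ) : ℤ))) (s := s)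
      (mul_nonneg hν.le (Real.rpow_nonneg hb0.le _)) (hcont i k) hq0
      (fun u hu => hder i k u hu) t ht
    have hw : (1 + ε₀) ^ (2 * θ * (k : ℝ)) * ((1 / 2 : ℝ) * X i (k : ℤ) t ^ 2) ≤
        (1 + ε₀) ^ (2 * θ * (k : ℝ)) * ((1 / 2 : ℝ) * X i (k : ℤ) 0 ^ 2) :=
      mul_le_mul_of_nonneg_left (by nlinarith [hsq]) (Real.rpow_nonneg hb0.le _)
    refine hw.trans ?_
    rw [hinit]
    by_cases hk : ((k : ℕ) : ℤ) = 0
    · have hk0 : k = 0 := by exact_mod_cast hk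
      subst hk0
      simp only [hk, if_true, Nat.cast_zero, mul_zero, Real.rpow_zero, one_mul]
      exact (hE₀i i).trans (by nlinarith [hE₀0])
    · simp only [hk, if_false]
      have : (0 : ℝ) ^ 2 = 0 := by norm_num
      rw [this, mul_zero, mul_zero]
      positivity
  · -- live strand: an honest `(c a₀)`-chain solution under the chain barrier
    obtain ⟨h1, h2, h3, h4, h5, h6⟩ := permStrand_honest (ν := ν) hcyc a₀ hinit hlow hbd hcont hder hnn
    have hB := hchain a₀ hc0 ν hν _ s hs (permStrand σ a₀ X) h1 h2 h3 h4 h5 h6 t ht 0 k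
    rw [permStrand_zero, hph] at hB
    refine hB.trans (mul_le_mul_of_nonneg_left ?_ hD0)
    have : (∑ j : Fin 4, (1 / 2 : ℝ) * (if j = 0 then X₀ a₀ else 0) ^ 2) =
        (1 / 2 : ℝ) * X₀ a₀ ^ 2 := by simp
    rw [this]
    exact hE₀i _

/-! ## §8 The rung on `ε₀ ∈ [31/50, 1]` (ns-soc-p2's chain regions BY NAME) -/

/-- **ν-UNIFORM SHELL BARRIER FOR UNIFORM KP PERMUTATION NETWORKS on `ε₀ ∈ [7/10, 1]`** (`θ = 101/200`,
`D = 100`; `c ≥ 0` constant on `σ`-orbits; every `ν > 0`, every one-shell datum): the transfer applied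
to ns-soc-p2's chain rung `dyadicRange_shellBarrier` (BY NAME).  MODEL lattice statement. [this file] -/
theorem kpPerm_shellBarrier_range {σ : Equiv.Perm (Fin 4)} {c : Fin 4 → ℝ} {ε₀ : ℝ}
    (hcyc : ∀ a, c (σ a) = c a) (hc : ∀ a, 0 ≤ c a) (hε : 7 / 10 ≤ ε₀) (hε1 : ε₀ ≤ 1) :
    ∀ ν : ℝ, 0 < ν → ∀ (X₀ : Fin 4 → ℝ) (s : ℝ), 0 < s → ∀ X : Fin 4 → ℤ → ℝ → ℝ,
      (∀ (i : Fin 4) (k : ℤ), X i k 0 = if k = 0 then X₀ i else 0) →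
      (∀ (i : Fin 4) (k : ℤ), k < 0 → ∀ t : ℝ, X i k t = 0) →
      (∃ M : ℝ, ∀ (t : ℝ) (i : Fin 4) (k : ℤ), (1 + (1 + ε₀) ^ ((10 : ℝ) * k)) * |X i k t| ≤ M) →
      (∀ (i : Fin 4) (k : ℤ), Continuous (X i k)) →
      (∀ (i : Fin 4) (k : ℤ), ∀ t ∈ Set.Icc (0 : ℝ) s, HasDerivWithinAt (X i k)
        (quadTerm ε₀ (kpPermTable σ c) X i k t - ν * (1 + ε₀) ^ ((2 : ℝ) * k) * X i k t)
        (Set.Icc (0 : ℝ) s) t) →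
      (∀ t ∈ Set.Icc (0 : ℝ) s, ∀ (i : Fin 4) (k : ℤ), 1 ≤ k → 0 ≤ X i k t) →
      ∀ t ∈ Set.Icc (0 : ℝ) s, ∀ (i : Fin 4) (k : ℕ),
        (1 + ε₀) ^ (2 * (101 / 200) * (k : ℝ)) * ((1 / 2 : ℝ) * X i (k : ℤ) t ^ 2) ≤
          100 * (∑ j : Fin 4, (1 / 2 : ℝ) * X₀ j ^ 2) :=
  kpPerm_shellBound_of_chain hcyc (by linarith) (by norm_num) fun a ha =>
    dyadicRange_shellBarrier (lt_of_le_of_ne (hc a) (Ne.symm ha)) hε hε1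
      (α := fun i₁ i₂ i₃ μ => c a * dyadicTable i₁ i₂ i₃ μ) (fun _ _ _ _ => rfl)

/-- **The same on the mid range `ε₀ ∈ [31/50, 18/25]`**, by the transfer applied to ns-soc-p2's
three-window chain rung `dyadicMidRange_shellBarrier` (BY NAME).  MODEL lattice statement.
[this file] -/
theorem kpPerm_shellBarrier_midRange {σ : Equiv.Perm (Fin 4)} {c : Fin 4 → ℝ} {ε₀ : ℝ}
    (hcyc : ∀ a, c (σ a) = c a) (hc : ∀ a, 0 ≤ c a) (hε : 31 / 50 ≤ ε₀) (hε1 : ε₀ ≤ 18 / 25) :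
    ∀ ν : ℝ, 0 < ν → ∀ (X₀ : Fin 4 → ℝ) (s : ℝ), 0 < s → ∀ X : Fin 4 → ℤ → ℝ → ℝ,
      (∀ (i : Fin 4) (k : ℤ), X i k 0 = if k = 0 then X₀ i else 0) →
      (∀ (i : Fin 4) (k : ℤ), k < 0 → ∀ t : ℝ, X i k t = 0) →
      (∃ M : ℝ, ∀ (t : ℝ) (i : Fin 4) (k : ℤ), (1 + (1 + ε₀) ^ ((10 : ℝ) * k)) * |X i k t| ≤ M) →
      (∀ (i : Fin 4) (k : ℤ), Continuous (X i k)) →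
      (∀ (i : Fin 4) (k : ℤ), ∀ t ∈ Set.Icc (0 : ℝ) s, HasDerivWithinAt (X i k)
        (quadTerm ε₀ (kpPermTable σ c) X i k t - ν * (1 + ε₀) ^ ((2 : ℝ) * k) * X i k t)
        (Set.Icc (0 : ℝ) s) t) →
      (∀ t ∈ Set.Icc (0 : ℝ) s, ∀ (i : Fin 4) (k : ℤ), 1 ≤ k → 0 ≤ X i k t) →
      ∀ t ∈ Set.Icc (0 : ℝ) s, ∀ (i : Fin 4) (k : ℕ),
        (1 + ε₀) ^ (2 * (101 / 200) * (k : ℝ)) * ((1 / 2 : ℝ) * X i (k : ℤ) t ^ 2) ≤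
          100 * (∑ j : Fin 4, (1 / 2 : ℝ) * X₀ j ^ 2) :=
  kpPerm_shellBound_of_chain hcyc (by linarith) (by norm_num) fun a ha =>
    dyadicMidRange_shellBarrier (lt_of_le_of_ne (hc a) (Ne.symm ha)) hε hε1
      (α := fun i₁ i₂ i₃ μ => c a * dyadicTable i₁ i₂ i₃ μ) (fun _ _ _ _ => rfl)

/-- **The rung in the skeletons' binder shape on the WIDE range**: `ShellBarrierAt R ε₀ (kpPermTable σ c)`
for every spread `R`, every `ε₀ ∈ [31/50, 1]`, every permutation `σ` and EVERY orbit-constant `c`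
(signs included: the orthant binder of `ShellBarrierAt` forces `c ≥ 0`, `kpPerm_coeff_nonneg_of_orthant`;
the table-class binder is idle).  MODEL lattice statement. [this file] -/
theorem kpPermWide_shellBarrierAt {σ : Equiv.Perm (Fin 4)} {c : Fin 4 → ℝ}
    (hcyc : ∀ a, c (σ a) = c a) :
    ∀ R : ℝ, ∀ ε₀ : ℝ, 31 / 50 ≤ ε₀ → ε₀ ≤ 1 → ShellBarrierAt R ε₀ (kpPermTable σ c) := by
  intro R ε₀ hε hε1 _hT hO
  have hc : ∀ a, 0 ≤ c a := kpPerm_coeff_nonneg_of_orthant hO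
  by_cases hmid : ε₀ ≤ 18 / 25
  · exact ⟨101 / 200, by norm_num, 100, by norm_num, kpPerm_shellBarrier_midRange hcyc hc hε hmid⟩
  · exact ⟨101 / 200, by norm_num, 100, by norm_num,
      kpPerm_shellBarrier_range hcyc hc (by linarith) hε1⟩

/-- **Tail ceiling for uniform KP permutation networks on `ε₀ ∈ [31/50, 1]`**, by the shell-barrier ⇒
ceiling glue. [this file] -/
theorem kpPermWide_ceilingAt {σ : Equiv.Perm (Fin 4)} {c : Fin 4 → ℝ} (hcyc : ∀ a, c (σ a) = c a) :
    ∀ R : ℝ, ∀ ε₀ : ℝ, 31 / 50 ≤ ε₀ → ε₀ ≤ 1 → CeilingAt R ε₀ (kpPermTable σ c) := by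
  intro R ε₀ hε hε1
  exact subOnsagerCeiling_ceilingAt_of_shellBarrierAt (by linarith)
    (kpPermWide_shellBarrierAt hcyc R ε₀ hε hε1)

/-- **The 27130 clause on the uniform KP permutation networks at every `ε₀ ∈ [31/50, 1]`**: `S = univ`,
margin `η = 2θ − 1 = 1/100`, window constant `C·Σ½X₀²` uniform in `T` and `ν`; the table-class and
orthant binders are consumed by `viscousTailEnvelopeOrthant_uniform_of_ceilingAt`, the diagonal-feed
binder is idle.  MODEL lattice statement; the crux 27130 is NOT proved (one architecture class, one
ratio range). [this file] -/
theorem forwardSourceTailEnvelopeKP_at_kpPerm {σ : Equiv.Perm (Fin 4)} {c : Fin 4 → ℝ}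
    (hcyc : ∀ a, c (σ a) = c a) :
    ∀ R : ℝ, 1 ≤ R → ∀ ε₀ : ℝ, 31 / 50 ≤ ε₀ → ε₀ ≤ 1 →
      InTableClass R (kpPermTable σ c) →
      (∀ (Y : Fin 4 → ℤ → ℝ → ℝ) (τ : ℝ), (∀ (j : Fin 4) (k : ℤ), 1 ≤ k → 0 ≤ Y j k τ) →
        ∀ δ : ℝ, 0 < δ → ∀ (i : Fin 4) (n : ℤ), 1 ≤ n → Y i n τ = 0 →
        0 ≤ quadTerm δ (kpPermTable σ c) Y i n τ) →
      (∀ a b i : Fin 4, a ≠ b → kpPermTable σ c a b i (0, 0, 1) = 0) →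
      ∃ S : Finset (Fin 4), (∀ i, i ∉ S → ∀ j l : Fin 4, kpPermTable σ c i j l (0, 0, 1) = 0) ∧
      ∀ X₀ : Fin 4 → ℝ, ∃ η : ℝ, 0 < η ∧ ∀ T : ℝ, 0 < T → ∃ C : ℝ, ∀ ν : ℝ, 0 < ν →
      ∀ s ∈ Set.Ioc (0 : ℝ) T, ∀ X : Fin 4 → ℤ → ℝ → ℝ,
      (∀ i k, X i k 0 = if k = 0 then X₀ i else 0) →
      (∀ i k, k < 0 → ∀ t, X i k t = 0) →
      (∃ M : ℝ, ∀ (t : ℝ) (i : Fin 4) (k : ℤ), (1 + (1 + ε₀) ^ ((10 : ℝ) * k)) * |X i k t| ≤ M) →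
      (∀ i k, Continuous (X i k)) →
      (∀ i k, ∀ t ∈ Set.Icc (0 : ℝ) s, HasDerivWithinAt (X i k)
        (quadTerm ε₀ (kpPermTable σ c) X i k t - ν * (1 + ε₀) ^ ((2 : ℝ) * k) * X i k t)
        (Set.Icc 0 s) t) →
      ∀ n N : ℕ, n ≤ N → ∀ t ∈ Set.Icc (0 : ℝ) s,
        ∑ k ∈ Finset.Icc n N, ∑ i ∈ S, (1 / 2) * X i (k : ℤ) t ^ 2 ≤
          C * (1 + ε₀) ^ (-((1 + η) * (n : ℝ))) := by
  intro R _hR ε₀ hε hε1 hα hK _hdiag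
  have hε0 : 0 < ε₀ := by linarith
  obtain ⟨η, hη, C, _hC0, H⟩ :=
    viscousTailEnvelopeOrthant_uniform_of_ceilingAt hε0 hα hK (kpPermWide_ceilingAt hcyc R ε₀ hε hε1)
  refine ⟨Finset.univ, fun i hi => absurd (Finset.mem_univ i) hi, fun X₀ =>
    ⟨η, hη, fun T _hT => ⟨C * (∑ i : Fin 4, (1 / 2 : ℝ) * X₀ i ^ 2),
      fun ν hν s hs X hinit hlow hbd hcont hder n N hnN t ht => ?_⟩⟩⟩
  exact H ν hν X₀ s hs.1 X hinit hlow hbd hcont hder n N hnN t ht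

/-- **The 27130 clause with the CANONICAL mode set `S := S⁺(α) = {a : c a ≠ 0}`** (the forward
sources): partial sums over a sub-family of modes are below the total, so the `S = univ` envelope
transfers with the same `η`, `C`.  MODEL lattice statement. [this file] -/
theorem forwardSourceTailEnvelopeKP_at_kpPerm_sources {σ : Equiv.Perm (Fin 4)} {c : Fin 4 → ℝ}
    (hcyc : ∀ a, c (σ a) = c a) :
    ∀ R : ℝ, 1 ≤ R → ∀ ε₀ : ℝ, 31 / 50 ≤ ε₀ → ε₀ ≤ 1 →
      InTableClass R (kpPermTable σ c) →
      (∀ (Y : Fin 4 → ℤ → ℝ → ℝ) (τ : ℝ), (∀ (j : Fin 4) (k : ℤ), 1 ≤ k → 0 ≤ Y j k τ) →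
        ∀ δ : ℝ, 0 < δ → ∀ (i : Fin 4) (n : ℤ), 1 ≤ n → Y i n τ = 0 →
        0 ≤ quadTerm δ (kpPermTable σ c) Y i n τ) →
      (∀ i, i ∉ (Finset.univ.filter fun a : Fin 4 => c a ≠ 0) →
        ∀ j l : Fin 4, kpPermTable σ c i j l (0, 0, 1) = 0) ∧
      ∀ X₀ : Fin 4 → ℝ, ∃ η : ℝ, 0 < η ∧ ∀ T : ℝ, 0 < T → ∃ C : ℝ, ∀ ν : ℝ, 0 < ν →
      ∀ s ∈ Set.Ioc (0 : ℝ) T, ∀ X : Fin 4 → ℤ → ℝ → ℝ,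
      (∀ i k, X i k 0 = if k = 0 then X₀ i else 0) →
      (∀ i k, k < 0 → ∀ t, X i k t = 0) →
      (∃ M : ℝ, ∀ (t : ℝ) (i : Fin 4) (k : ℤ), (1 + (1 + ε₀) ^ ((10 : ℝ) * k)) * |X i k t| ≤ M) →
      (∀ i k, Continuous (X i k)) →
      (∀ i k, ∀ t ∈ Set.Icc (0 : ℝ) s, HasDerivWithinAt (X i k)
        (quadTerm ε₀ (kpPermTable σ c) X i k t - ν * (1 + ε₀) ^ ((2 : ℝ) * k) * X i k t)
        (Set.Icc 0 s) t) →
      ∀ n N : ℕ, n ≤ N → ∀ t ∈ Set.Icc (0 : ℝ) s,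
        ∑ k ∈ Finset.Icc n N, ∑ i ∈ (Finset.univ.filter fun a : Fin 4 => c a ≠ 0),
          (1 / 2) * X i (k : ℤ) t ^ 2 ≤ C * (1 + ε₀) ^ (-((1 + η) * (n : ℝ))) := by
  intro R _hR ε₀ hε hε1 hα hK
  refine ⟨kpPermTable_sourceComplete σ c, fun X₀ => ?_⟩
  have hε0 : 0 < ε₀ := by linarith
  obtain ⟨η, hη, C, _hC0, H⟩ :=
    viscousTailEnvelopeOrthant_uniform_of_ceilingAt hε0 hα hK (kpPermWide_ceilingAt hcyc R ε₀ hε hε1)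
  refine ⟨η, hη, fun T _hT => ⟨C * (∑ i : Fin 4, (1 / 2 : ℝ) * X₀ i ^ 2),
    fun ν hν s hs X hinit hlow hbd hcont hder n N hnN t ht => ?_⟩⟩
  have hfull := H ν hν X₀ s hs.1 X hinit hlow hbd hcont hder n N hnN t ht
  refine le_trans (Finset.sum_le_sum fun k _ => ?_) hfull
  exact Finset.sum_le_univ_sum_of_nonneg fun i => by positivity

end Summit.NavierStokesRegularity.NavierStokesRegularity.Theorems

end
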